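import Summits.Ventures.PercRepro.C041BlockMapLocalReductions
import Summits.Ventures.PercRepro.C041BlockMapSubdiv

/-!
# ROW C-041 — THE SERIES REDUCTION ON ARBITRARY HOSTS: a non-terminal vertex of degree two is a subdivision
(p6, gen 37; the general form of THEOREM (SUBDIVISION) §17 of proofs/P6-TWOEXIT-LEAN.md, for a given host)

For an unmarked host `Z` and a vertex `x` (not an exit, not the anchor) whose incident edges are exactly two
non-loops `e₁ ≠ e₂` — to the neighbours `p = other e₁` and `q = other e₂` — the host `Z` is isomorphic to the
SUBDIVISION, at the edge `e₁` re-ended to `p – q`, of the host `seriesRest` on the vertices other than `x` and the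
edges other than `e₂` (`series_joins_iff`).  **THE SERIES REDUCTION** (`coneHost_of_series`): `Z` is a cone host
at `u` as soon as `seriesRest` and `seriesRest` with the edge `e₁` deleted are (THEOREM (SUBDIVISION) in its
deletion form, `inCone_blockMap_subdiv_del`).  With the loop, parallel and degree-`≤ 1` reductions
(`C041BlockMapLocalReductions`) and THEOREM (CUT VERTEX), every reducible feature of a host is now a kernel step;
the induction «cores ⟹ all hosts» is `C041BlockMapCores`.
-/

namespace PercRepro

namespace ZoneZ

namespace MultiExit

open ZoneData Pendant Finset TwoExit TreeClosure

section Series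

variable {V E : Type} (Z : ZoneData V E Empty Empty) [DecidableEq V] [DecidableEq E] [Fintype E] (x : V)

/-- The other end of an edge at `x`. -/
def other (e : E) : V := if Z.fst e = x then Z.snd e else Z.fst e

omit [DecidableEq E] [Fintype E] in
/-- The other end of a non-loop at `x` is not `x`. -/
theorem other_ne {e : E} (T : Z.fst e = x ∨ Z.snd e = x) (L : Z.fst e ≠ Z.snd e) : other Z x e ≠ x := by
  unfold other
  split_ifs with h
  · intro h'
    exact L (h.trans h'.symm)
  · rcases T with T | T
    · exact absurd T h
    · intro h'
      exact L (h'.trans T.symm)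

omit [DecidableEq E] [Fintype E] in
/-- An edge at `x` joins `x` and its other end. -/
theorem joins_other {e : E} (T : Z.fst e = x ∨ Z.snd e = x) : Z.Joins e x (other Z x e) := by
  unfold other ZoneData.Joins
  split_ifs with h
  · exact Or.inl ⟨h, rfl⟩
  · rcases T with T | T
    · exact absurd T h
    · exact Or.inr ⟨rfl, T⟩

omit [DecidableEq V] [DecidableEq E] [Fintype E] in
/-- The incidences of an edge joining `y` and `z`. -/
theorem joins_iff_pair {e : E} {y z : V} (h : Z.Joins e y z) (X Y : V) :
    Z.Joins e X Y ↔ (X = y ∧ Y = z) ∨ (X = z ∧ Y = y) := by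
  unfold ZoneData.Joins at h ⊢
  rcases h with ⟨h1, h2⟩ | ⟨h1, h2⟩
  · rw [h1, h2]
    exact ⟨fun h => h.elim (fun h => Or.inl ⟨h.1.symm, h.2.symm⟩) fun h => Or.inr ⟨h.2.symm, h.1.symm⟩,
      fun h => h.elim (fun h => Or.inl ⟨h.1.symm, h.2.symm⟩) fun h => Or.inr ⟨h.2.symm, h.1.symm⟩⟩
  · rw [h1, h2]
    exact ⟨fun h => h.elim (fun h => Or.inr ⟨h.1.symm, h.2.symm⟩) fun h => Or.inl ⟨h.2.symm, h.1.symm⟩,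
      fun h => h.elim (fun h => Or.inr ⟨h.2.symm, h.1.symm⟩) fun h => Or.inl ⟨h.1.symm, h.2.symm⟩⟩

variable (e₁ e₂ : E) (hx : ∀ f, f ≠ e₁ → f ≠ e₂ → Z.fst f ≠ x ∧ Z.snd f ≠ x) (hp : other Z x e₁ ≠ x)
  (hq : other Z x e₂ ≠ x)

/-- THE HOST WITHOUT THE SERIES VERTEX: the vertices other than `x`, the edges other than `e₂`, the edge `e₁`
re-ended to the two neighbours. -/
def seriesRest : ZoneData {y // y ≠ x} {f // f ≠ e₂} Empty Empty where
  fst := fun f => if hf : f.1 = e₁ then ⟨other Z x e₁, hp⟩ else ⟨Z.fst f.1, (hx f.1 hf f.2).1⟩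
  snd := fun f => if hf : f.1 = e₁ then ⟨other Z x e₂, hq⟩ else ⟨Z.snd f.1, (hx f.1 hf f.2).2⟩
  at₁ := Empty.elim
  at₂ := Empty.elim

variable (hne : e₁ ≠ e₂)

/-- The subdivided host. -/
abbrev seriesSubdiv : ZoneData (Option {y // y ≠ x}) (Option {f // f ≠ e₂}) Empty Empty :=
  subdiv (seriesRest Z x e₁ e₂ hx hp hq) ⟨e₁, hne⟩

/-- The vertex equivalence: `none ↦ x`. -/
abbrev seriesVertexEquiv : Option {y // y ≠ x} ≃ V := Equiv.optionSubtypeNe x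

/-- The edge equivalence: `none ↦ e₂`. -/
abbrev seriesEdgeEquiv : Option {f // f ≠ e₂} ≃ E := Equiv.optionSubtypeNe e₂

/-- A vertex map equation: `fv o = x ↔ o = none`. -/
theorem seriesVertexEquiv_eq_x (o : Option {y // y ≠ x}) : Equiv.optionSubtypeNe x o = x ↔ o = none := by
  constructor
  · intro h
    have := (Equiv.optionSubtypeNe x).injective (h.trans (Equiv.optionSubtypeNe_none x).symm)
    exact this
  · rintro rfl
    exact Equiv.optionSubtypeNe_none x

/-- A vertex map equation: `fv o = y ↔ o = some ⟨y, _⟩`. -/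
theorem seriesVertexEquiv_eq_some (o : Option {y // y ≠ x}) (y : V) (hy : y ≠ x) :
    Equiv.optionSubtypeNe x o = y ↔ o = some ⟨y, hy⟩ := by
  constructor
  · intro h
    exact (Equiv.optionSubtypeNe x).injective (h.trans (Equiv.optionSubtypeNe_some x ⟨y, hy⟩).symm)
  · rintro rfl
    exact Equiv.optionSubtypeNe_some x ⟨y, hy⟩

omit [Fintype E] in
/-- The ends of `seriesRest` at `e₁`. -/
theorem rest_fst_e₁ : (seriesRest Z x e₁ e₂ hx hp hq).fst ⟨e₁, hne⟩ = ⟨other Z x e₁, hp⟩ := by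
  show (if hf : e₁ = e₁ then _ else _) = _
  rw [dif_pos rfl]

omit [Fintype E] in
/-- The ends of `seriesRest` at `e₁`. -/
theorem rest_snd_e₁ : (seriesRest Z x e₁ e₂ hx hp hq).snd ⟨e₁, hne⟩ = ⟨other Z x e₂, hq⟩ := by
  show (if hf : e₁ = e₁ then _ else _) = _
  rw [dif_pos rfl]

omit [Fintype E] in
/-- The ends of `seriesRest` at another edge. -/
theorem rest_fst_ne (f : E) (hf : f ≠ e₂) (hf1 : f ≠ e₁) :
    (seriesRest Z x e₁ e₂ hx hp hq).fst ⟨f, hf⟩ = ⟨Z.fst f, (hx f hf1 hf).1⟩ := by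
  show (if hf' : f = e₁ then _ else _) = _
  rw [dif_neg hf1]

omit [Fintype E] in
/-- The ends of `seriesRest` at another edge. -/
theorem rest_snd_ne (f : E) (hf : f ≠ e₂) (hf1 : f ≠ e₁) :
    (seriesRest Z x e₁ e₂ hx hp hq).snd ⟨f, hf⟩ = ⟨Z.snd f, (hx f hf1 hf).2⟩ := by
  show (if hf' : f = e₁ then _ else _) = _
  rw [dif_neg hf1]

omit [Fintype E] in
/-- The second end of the new edge of the subdivision. -/
theorem ssub_snd_none : (seriesSubdiv Z x e₁ e₂ hx hp hq hne).snd none = some ⟨other Z x e₂, hq⟩ := by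
  show some ((seriesRest Z x e₁ e₂ hx hp hq).snd ⟨e₁, hne⟩) = _
  rw [rest_snd_e₁]

omit [Fintype E] in
/-- The second end of the edge `e₁` of the subdivision. -/
theorem ssub_snd_e₁ : (seriesSubdiv Z x e₁ e₂ hx hp hq hne).snd (some ⟨e₁, hne⟩) = none := by
  show (if (⟨e₁, hne⟩ : {f // f ≠ e₂}) = ⟨e₁, hne⟩ then none else _) = _
  rw [if_pos rfl]

omit [Fintype E] in
/-- The second end of another edge of the subdivision. -/
theorem ssub_snd_ne (f : E) (hf : f ≠ e₂) (hf1 : f ≠ e₁) :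
    (seriesSubdiv Z x e₁ e₂ hx hp hq hne).snd (some ⟨f, hf⟩) = some ((seriesRest Z x e₁ e₂ hx hp hq).snd ⟨f, hf⟩) := by
  show (if (⟨f, hf⟩ : {f // f ≠ e₂}) = ⟨e₁, hne⟩ then none else _) = _
  rw [if_neg fun h => hf1 (Subtype.ext_iff.1 h)]

omit [Fintype E] in
/-- **THE SERIES DECOMPOSITION**: the incidences of `Z` are those of the subdivision of `seriesRest` at `e₁`. -/
theorem series_joins_iff (T₁ : Z.fst e₁ = x ∨ Z.snd e₁ = x) (T₂ : Z.fst e₂ = x ∨ Z.snd e₂ = x)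
    (f : Option {f // f ≠ e₂}) (o o' : Option {y // y ≠ x}) :
    Z.Joins (Equiv.optionSubtypeNe e₂ f) (Equiv.optionSubtypeNe x o) (Equiv.optionSubtypeNe x o') ↔
      (seriesSubdiv Z x e₁ e₂ hx hp hq hne).Joins f o o' := by
  rcases f with _ | ⟨f, hf⟩
  · -- the new edge `none` is `e₂`, joining `x` (= `none`) and `q`
    rw [Equiv.optionSubtypeNe_none, joins_iff_pair Z (joins_other Z x T₂)]
    unfold ZoneData.Joins
    rw [ssub_snd_none]
    show _ ↔ (none = o ∧ some ⟨other Z x e₂, hq⟩ = o') ∨ (none = o' ∧ some ⟨other Z x e₂, hq⟩ = o)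
    constructor
    · rintro (⟨h1, h2⟩ | ⟨h1, h2⟩)
      · exact Or.inl ⟨((seriesVertexEquiv_eq_x x o).1 h1).symm, ((seriesVertexEquiv_eq_some x o' _ hq).1 h2).symm⟩
      · exact Or.inr ⟨((seriesVertexEquiv_eq_x x o').1 h2).symm, ((seriesVertexEquiv_eq_some x o _ hq).1 h1).symm⟩
    · rintro (⟨h1, h2⟩ | ⟨h1, h2⟩)
      · exact Or.inl ⟨(seriesVertexEquiv_eq_x x o).2 h1.symm, (seriesVertexEquiv_eq_some x o' _ hq).2 h2.symm⟩
      · exact Or.inr ⟨(seriesVertexEquiv_eq_some x o _ hq).2 h2.symm, (seriesVertexEquiv_eq_x x o').2 h1.symm⟩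
  · rw [Equiv.optionSubtypeNe_some]
    by_cases hf1 : f = e₁
    · -- the edge `e₁`, joining `p` and `x` (= `none`)
      have hsub : (⟨f, hf⟩ : {f // f ≠ e₂}) = ⟨e₁, hne⟩ := Subtype.ext hf1
      rw [hsub]
      show Z.Joins e₁ _ _ ↔ _
      rw [joins_iff_pair Z (joins_other Z x T₁)]
      unfold ZoneData.Joins
      rw [ssub_snd_e₁]
      show _ ↔ (some ((seriesRest Z x e₁ e₂ hx hp hq).fst ⟨e₁, hne⟩) = o ∧ none = o') ∨
        (some ((seriesRest Z x e₁ e₂ hx hp hq).fst ⟨e₁, hne⟩) = o' ∧ none = o)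
      rw [rest_fst_e₁]
      constructor
      · rintro (⟨h1, h2⟩ | ⟨h1, h2⟩)
        · exact Or.inr ⟨((seriesVertexEquiv_eq_some x o' _ hp).1 h2).symm, ((seriesVertexEquiv_eq_x x o).1 h1).symm⟩
        · exact Or.inl ⟨((seriesVertexEquiv_eq_some x o _ hp).1 h1).symm, ((seriesVertexEquiv_eq_x x o').1 h2).symm⟩
      · rintro (⟨h1, h2⟩ | ⟨h1, h2⟩)
        · exact Or.inr ⟨(seriesVertexEquiv_eq_some x o _ hp).2 h1.symm, (seriesVertexEquiv_eq_x x o').2 h2.symm⟩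
        · exact Or.inl ⟨(seriesVertexEquiv_eq_x x o).2 h2.symm, (seriesVertexEquiv_eq_some x o' _ hp).2 h1.symm⟩
    · -- any other edge: its ends are not `x`
      unfold ZoneData.Joins
      rw [ssub_snd_ne Z x e₁ e₂ hx hp hq hne f hf hf1]
      show _ ↔ (some ((seriesRest Z x e₁ e₂ hx hp hq).fst ⟨f, hf⟩) = o ∧
          some ((seriesRest Z x e₁ e₂ hx hp hq).snd ⟨f, hf⟩) = o') ∨
        (some ((seriesRest Z x e₁ e₂ hx hp hq).fst ⟨f, hf⟩) = o' ∧
          some ((seriesRest Z x e₁ e₂ hx hp hq).snd ⟨f, hf⟩) = o)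
      rw [rest_fst_ne Z x e₁ e₂ hx hp hq f hf hf1, rest_snd_ne Z x e₁ e₂ hx hp hq f hf hf1]
      have hF := (hx f hf1 hf).1
      have hS := (hx f hf1 hf).2
      constructor
      · rintro (⟨h1, h2⟩ | ⟨h1, h2⟩)
        · exact Or.inl ⟨((seriesVertexEquiv_eq_some x o _ hF).1 h1.symm).symm,
            ((seriesVertexEquiv_eq_some x o' _ hS).1 h2.symm).symm⟩
        · exact Or.inr ⟨((seriesVertexEquiv_eq_some x o' _ hF).1 h1.symm).symm,
            ((seriesVertexEquiv_eq_some x o _ hS).1 h2.symm).symm⟩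
      · rintro (⟨h1, h2⟩ | ⟨h1, h2⟩)
        · exact Or.inl ⟨((seriesVertexEquiv_eq_some x o _ hF).2 h1.symm).symm,
            ((seriesVertexEquiv_eq_some x o' _ hS).2 h2.symm).symm⟩
        · exact Or.inr ⟨((seriesVertexEquiv_eq_some x o' _ hF).2 h1.symm).symm,
            ((seriesVertexEquiv_eq_some x o _ hS).2 h2.symm).symm⟩

/-- **THE SERIES REDUCTION**: a host with a non-terminal vertex `x` of degree two (the non-loops `e₁ ≠ e₂`, no
other edge at `x`) is a cone host at `u` as soon as the host without `x` (the edge `e₁` re-ended to the two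
neighbours) and that host with `e₁` deleted are. -/
theorem coneHost_of_series (T₁ : Z.fst e₁ = x ∨ Z.snd e₁ = x) (T₂ : Z.fst e₂ = x ∨ Z.snd e₂ = x) {ι : Type}
    [Fintype ι] [DecidableEq ι] (u : ι → V) (a : V) (hu : ∀ k, u k ≠ x) (ha : a ≠ x)
    (h₁ : ConeHost (seriesRest Z x e₁ e₂ hx hp hq) (fun k => ⟨u k, hu k⟩) ⟨a, ha⟩)
    (h₂ : ConeHost (del (seriesRest Z x e₁ e₂ hx hp hq) ⟨e₁, hne⟩) (fun k => ⟨u k, hu k⟩) ⟨a, ha⟩) :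
    ConeHost Z u a := by
  have hs : ConeHost (seriesSubdiv Z x e₁ e₂ hx hp hq hne) (fun k => some ⟨u k, hu k⟩) (some ⟨a, ha⟩) := by
    intro w hw
    exact inCone_blockMap_subdiv_del _ _ _ _ w (h₁ w hw) (h₂ w hw)
  refine coneHost_of_iso' (seriesSubdiv Z x e₁ e₂ hx hp hq hne) Z (Equiv.optionSubtypeNe x)
    (Equiv.optionSubtypeNe e₂) (series_joins_iff Z x e₁ e₂ hx hp hq hne T₁ T₂) u a ?_
  have hu' : (Equiv.optionSubtypeNe x).symm ∘ u = fun k => some ⟨u k, hu k⟩ := by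
    funext k
    exact Equiv.optionSubtypeNe_symm_of_ne (hu k)
  have ha' : (Equiv.optionSubtypeNe x).symm a = some ⟨a, ha⟩ := Equiv.optionSubtypeNe_symm_of_ne ha
  rw [hu', ha']
  exact hs

end Series

end MultiExit

end ZoneZ

end PercRepro
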